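import Mathlib
import Literature.Computability.Complexity.ExtMonotoneGates
import Summits.PneNP.PneNP.Theorems.ConvexRankGatesLinAlgGateBlindTutteIsGRank
import Summits.PneNP.PneNP.Theorems.ConvexRankGatesCaptureSignedCover
import Summits.PneNP.PneNP.Theorems.ConvexRankGatesCaptureSignedMatching

/-!
# Route ConvexRankGates, crux `Capture` (stmt-PneNP-2659): the UNBALANCED-CYCLE door is ONE GRANK gate
(file 5/5 — PQ cell "`M / t` graphic"; non-bipartiteness of the selected subgraph)

Support theorem for the crux `Summit.PneNP.PneNP.Theses.ConvexRankGates.Capture` (lead c10), a NEW positive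
one-gate theorem for the disprover's open question PQ ("is `𝔽₂`-span membership — the abelian PERM door — ONE
GRANK gate?"). In binary-matroid language a span gate `v ↦ [t ∈ span {a_i : v_i = 1}]` is the PORT of `M = [A | t]`
at `t`; lead c8 did `M ∖ t` graphic (T-joins, by a Pfaffian pairing of transfer polynomials); this file does
`M / t` GRAPHIC, i.e. ports of signed-graphic (even-cycle) binary matroids at the sign element:

* `unbalanced_isGRankGate` (registered anchor) — for a signed edge list `(p i, q i, o i)`, `i : Fin n`, on a finite
  `V`, the monotone function `v ↦ [the selected signed subgraph is UNBALANCED]` (a closed walk with an odd number of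
  odd edges; `Unbalanced`) is `IsGRankGate (4|V|² + 2)`;
* `signedSpan_isGRankGate` — the same in the PERM door's vocabulary:
  `v ↦ [(1, 0) ∈ span_{𝔽₂} {(o_i ; e_{p_i} + e_{q_i}) : v_i = 1}]` (`unbalanced_iff_mem_span`);
* `nonBipartite_isGRankGate` — all signs odd, no loops: `v ↦ [the selected subgraph is NOT 2-colourable]`.

Mechanism (new for the route, elementary): the door is a polynomial MONOTONE PROJECTION OF PERFECT MATCHING — the
wire-controlled gadget `gadget p q o v` (signed double cover, `in/out` split, one replica per root vertex, two
absorbers `g, g'` whose parity forces exactly one replica into path mode) has a perfect matching iff the selection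
is unbalanced (`exists_isPerfectMatching_iff_unbalanced`, files 3–4), and TUTTE gates are GRANK gates of the same
dimension (`isGRankGate_of_tutteGate`, Tutte 1947 in gate form; relabelling `gadgetIso` to `Fin d`). The function is
in monotone P (OR of USTCONN instances on the double cover), so as Capture-evidence it is a normal-form statement; its
point is the PQ frontier: graphic (`M ∖ t`, c8) and dual-graphic (`M / t`, here) ports are single GRANK gates, while
weight-≥ 3 `𝔽₂`-systems (3-XOR-SAT, the GKRS door) admit NO all-or-nothing matching gadget of arity ≥ 3 (realisable
terminal families of matching gadgets are Δ-matroids — Bouchet), so for them "∈ mProj(PM)?" and "∈ GRANK?" stay open.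
No new definitions. [folklore]
-/

namespace Summit.PneNP.PneNP.Theorems.Capture.Signed

set_option linter.dupNamespace false -- `Summit.PneNP.PneNP.…`: summit = sub-problem (D-0017)

open SimpleGraph Literature.Computability.Complexity

/-- Perfect matchings transport along graph isomorphisms. [folklore] -/
theorem exists_isPerfectMatching_of_iso {W W' : Type} {G : SimpleGraph W} {G' : SimpleGraph W'} (φ : G ≃g G')
    (h : ∃ M : G.Subgraph, M.IsPerfectMatching) : ∃ M' : G'.Subgraph, M'.IsPerfectMatching := by
  obtain ⟨M, hM⟩ := h
  refine ⟨M.map φ.toHom, (Subgraph.Iso.isMatching_map φ).2 hM.1, fun x => ?_⟩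
  rw [Subgraph.map_verts]
  exact ⟨φ.symm x, hM.2 _, by simp⟩

/-- **The unbalanced-cycle door is ONE GRANK gate** (registered anchor). For a signed edge list `(p i, q i, o i)`,
`i : Fin n`, on a finite vertex type `V`, the monotone Boolean function `v ↦ [the selected signed subgraph is
unbalanced]` (some vertex has its two lifts connected in the signed double cover; equivalently some closed walk uses
an odd number of odd edges) is `IsGRankGate (4|V|² + 2)`: it is the perfect-matching function of the wire-controlled
gadget `gadget p q o v` (`exists_isPerfectMatching_iff_unbalanced`), and TUTTE gates are GRANK gates of the same
dimension (`isGRankGate_of_tutteGate`, Tutte 1947 in gate form). [folklore] -/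
theorem unbalanced_isGRankGate : ∀ {V : Type} [Fintype V] [DecidableEq V] {n : ℕ} (p q : Fin n → V)
    (o : Fin n → Bool) (f : (Fin n → Bool) → Bool), (∀ v, f v = true ↔ Unbalanced p q o v) →
    IsGRankGate (4 * Fintype.card V ^ 2 + 2) ⟨n, f⟩ := by
  intro V _ _ n p q o f hf
  refine isGRankGate_of_tutteGate (card_GV (V := V)).le (finCell₀ V) (fun i => finCellW p q o i) fun v => ?_
  rw [hf v, ← exists_isPerfectMatching_iff_unbalanced]
  exact ⟨exists_isPerfectMatching_of_iso (gadgetIso v), exists_isPerfectMatching_of_iso (gadgetIso v).symm⟩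

/-- **PQ, case `M / t` graphic: ports of signed-graphic binary matroids at the sign element are ONE GRANK gate.**
In the PERM door's own vocabulary: the gate accepting `v` iff
`(1, 0) ∈ span_{𝔽₂} {(o_i ; e_{p_i} + e_{q_i}) : v_i = 1}` (in `𝔽₂ × 𝔽₂^V`) is `IsGRankGate (4|V|² + 2)`. [folklore] -/
theorem signedSpan_isGRankGate {V : Type} [Fintype V] [DecidableEq V] {n : ℕ} (p q : Fin n → V) (o : Fin n → Bool)
    (f : (Fin n → Bool) → Bool)
    (hf : ∀ v, f v = true ↔ ((1 : ZMod 2), (0 : V → ZMod 2)) ∈ Submodule.span (ZMod 2)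
      ((fun i => (((if o i then 1 else 0) : ZMod 2),
        (Pi.single (p i) (1 : ZMod 2) + Pi.single (q i) 1 : V → ZMod 2))) '' {i | v i = true})) :
    IsGRankGate (4 * Fintype.card V ^ 2 + 2) ⟨n, f⟩ :=
  unbalanced_isGRankGate p q o f fun v => (hf v).trans (unbalanced_iff_mem_span (p := p) (q := q) (o := o)).symm

/-- **NON-BIPARTITENESS of the selected subgraph is ONE GRANK gate**: for a loop-free edge list `(p i, q i)` on `V`,
the monotone function `v ↦ [the graph with the selected edges is not 2-colourable]` is `IsGRankGate (4|V|² + 2)`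
(all signs odd in `unbalanced_isGRankGate`; `colorable_two_iff_not_unbalanced`). [folklore] -/
theorem nonBipartite_isGRankGate {V : Type} [Fintype V] [DecidableEq V] {n : ℕ} (p q : Fin n → V)
    (hpq : ∀ i, p i ≠ q i) (f : (Fin n → Bool) → Bool)
    (hf : ∀ v, f v = true ↔
      ¬ (SimpleGraph.fromRel fun a b : V => ∃ i, v i = true ∧ a = p i ∧ b = q i).Colorable 2) :
    IsGRankGate (4 * Fintype.card V ^ 2 + 2) ⟨n, f⟩ :=
  unbalanced_isGRankGate p q (fun _ => true) f fun v =>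
    (hf v).trans ((not_congr (colorable_two_iff_not_unbalanced (p := p) (q := q) hpq)).trans not_not)

/-- The door is an extended monotone gate: `⟨n, f⟩ ∈ extGate (4|V|² + 2)`. [folklore] -/
theorem unbalanced_mem_extGate {V : Type} [Fintype V] [DecidableEq V] {n : ℕ} (p q : Fin n → V) (o : Fin n → Bool)
    (f : (Fin n → Bool) → Bool) (hf : ∀ v, f v = true ↔ Unbalanced p q o v) :
    (⟨n, f⟩ : GateFn) ∈ extGate (4 * Fintype.card V ^ 2 + 2) :=
  (unbalanced_isGRankGate p q o f hf).mem_extGate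

/-- The door is monotone (sanity: every extended gate is). [folklore] -/
theorem unbalanced_gate_monotone {V : Type} {n : ℕ} (p q : Fin n → V) (o : Fin n → Bool)
    (f : (Fin n → Bool) → Bool) (hf : ∀ v, f v = true ↔ Unbalanced p q o v) : Monotone f :=
  monotone_of_forall_iff hf fun _ _ hvw hv => hv.mono hvw

end Summit.PneNP.PneNP.Theorems.Capture.Signed
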